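import Summits.BirchSwinnertonDyer.BirchSwinnertonDyer.Theorems.PrintX8SharpFlatMuTransfer
import Summits.BirchSwinnertonDyer.BirchSwinnertonDyer.Theorems.SignedLowerHalvesKobayashiMainConjectureSmallImageSignedMuDefect
import HarnessLib

/-!
# Route `PrintX8`, crux `MuBoundSmallImageX8` (stmt-BirchSwinnertonDyer-20622): LEMMA B «F1-sequence ∧
# μ(X₀(E/ℚ_∞)) = 0 ⟹ μ(X^•) ≤ μ(Λ/(L^•))» (every colour with `L^• ≠ 0`) and the ONE-colour transfer
# «one colour of unit content ⟹ μ(X₀) = 0 ⟹ the bound for every colour», at ANY image, ANY supersingular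
# `a_p` (cell `bsd-print-x8`, seat p1 gen 2, PLAN v1.2 §2 «lemma B is p1's; p2 consumes it»;
# route-independent; `--supports` 20622; theorems only)

PARTITION (cell bsd-print-x8, leaf `ClassX8`; the 61 small-image cells of crux 20622): types-the-object-of;
closes NONE; 0 cells move; beyond-print theorem: no; BSD is not proved by any of this. Crux 20622 (the
μ-part of Kato's divisibility for `Sel^{♯/♭}` at image `N_ns⁺(3)`) is OPEN. This is the ♯/♭ twin of
bsd-ssimc's `…SmallImageSignedMuDefect.lean` §2 / `…SmallImageSignedMuConjA.lean` §1 (k3-c4x, `a_p = 0`):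
the generic four-term identity of `SmallImageSignedMuDefect` §1 (imported) applied to the ♯/♭ package
`Sprung2012.SharpFlatColemanKatoData` (construction fact `thm714seq_sharpFlatColemanKato_zeta`, p543968) —
Sprung 2012 Prop. 7.19 on pinned objects, prime by prime (`colMap` injective because `L^• ≠ 0`). The two
SUPPLIES of `μ(X₀) = 0`: (a) ONE colour's analytic rider through the reduction-free core (§3, seat p1);
(b) Coates–Sujatha's Conjecture A at `(E, 3)` (seat p2 g2's road, consuming §2).

Contents: §1 `SharpFlatColemanKatoData.lengthAt_add_eq` / `….lengthAt_le_fine_add`; §2 LEMMA B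
`sharpFlat_lengthAt_le_of_fine_lengthAt_eq_zero` (any `p ∣ a_p`, `|ϖ|_p = 1` displayed), the X8 form and
the `μ`-currency form `X8.sharpFlatMu_le_of_fine_lengthAt_eq_zero` (the conclusion shape of 20622); §3
`fine_lengthAt_eq_zero_of_sharpFlatUnitContent` (+ X8 form) and the bridge
`muInvariant_quotient_span_eq_zero_iff_hasUnitContent`; §4 per pair, the planner's BC3 stub shape
`stub_muTransfer_of_oneColourMuZero`: `X8.sharpFlatMu_le_of_oneColour_hasUnitContent` / `…_muZero`. The
BY-NAME closers of `Theses.PrintX8.MuBoundSmallImageX8` live in `PrintX8SharpFlatMuBoundGlue.lean`.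
References: [Sprung2012] Def. 6.1, Props. 7.3/7.6, Thm. 7.14 (3), Prop. 7.19 (pp. 1495–1505);
[Kato2004Asterisque] Thm. 12.6 (p. 222), §13.8, §17.13 (p. 280); [CoatesSujatha2005] Conj. A;
[Washington1997] §13.2; tree: `SmallImageSignedMuDefect` §1, `SmallImageSignedMuTransfer` (OneSign §Algebra),
this seat's `PrintX8SharpFlatMuTransfer` (p545102).
-/

set_option linter.dupNamespace false
set_option autoImplicit false

noncomputable section

open scoped Classical NumberField MatrixGroups ModularForm

open NumberField IsDedekindDomain WeierstrassCurve CongruenceSubgroup Field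
  Literature.NumberTheory.EllipticCurves Literature.NumberTheory.EllipticCurves.ModularForms
  Literature.NumberTheory.EllipticCurves.Rank1Residual
  Literature.NumberTheory.EllipticCurves.Sprung2017 Literature.NumberTheory.EllipticCurves.Sprung2012
  Literature.NumberTheory.EllipticCurves.Kato2004 Literature.NumberTheory.EllipticCurves.GreenbergVatsal2000
  Literature.NumberTheory.EllipticCurves.ZpExtension Literature.NumberTheory.EllipticCurves.IwasawaAlgebra
  Summit.BirchSwinnertonDyer.BirchSwinnertonDyer.Rank1Residual
  Summit.BirchSwinnertonDyer.BirchSwinnertonDyer.Theorems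
  Summit.BirchSwinnertonDyer.BirchSwinnertonDyer.Theorems.SmallImageSignedMuTransfer
  Summit.BirchSwinnertonDyer.BirchSwinnertonDyer.Theorems.SmallImageSignedMuDefect
  Summit.BirchSwinnertonDyer.Rank1Residual.Supersingular

namespace Summit.BirchSwinnertonDyer.BirchSwinnertonDyer.Theorems.PrintX8SharpFlatMuTransfer

/-! ### §1 The four-term identity on the ♯/♭ package (Sprung 2012 Prop. 7.19, prime by prime) -/

section Package

variable (W : WeierstrassCurve ℚ) [W.IsElliptic] (p : ℕ) [Fact p.Prime]

/-- **The ♯/♭ `μ`/`λ`-defect identity, prime by prime (Sprung 2012 Prop. 7.19 ∕ Kato §17.13 on pinned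
objects):** for a package `C`, `E[p]` irreducible, a Sprung pair with `L^• ≠ 0` (so `colMap` is injective)
and Néron normalisation `G₁` (`ι G₁ = C(ϖ)·ι L^•`), dual data `D` of `Sel^•(E/ℚ_∞)` and `Y` of
`Sel₀(ℚ_∞, E[p^∞])`, every height-one `𝔭`: `length_𝔭 X^• + length_𝔭 (𝐇¹/Z) = length_𝔭 X₀ +
length_𝔭 Λ/(G₁)`; at `𝔭 = (p)`: `μ(X^•) + μ(𝐇¹/Z) = μ(X₀) + μ(L^•_p)`. CONDITIONAL only on the package.
[cite: Sprung2012, Thm. 7.14 (3) (p. 1504) and Prop. 7.19 (p. 1505)] [cite: Kato2004Asterisque, §17.13 (p. 280)] -/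
theorem _root_.Literature.NumberTheory.EllipticCurves.Sprung2012.SharpFlatColemanKatoData.lengthAt_add_eq
    [ContinuousSMul ℤ_[p] (W.tateModule p)] [Module.Free ℤ_[p] (W.tateModule p)]
    [Module.Finite ℤ_[p] (W.tateModule p)]
    {N : ℕ} {f : CuspForm (Gamma0 N) 2} {ϖ : ℚ} {κ : ZpExtension ℚ p} {γ : absoluteGaloisGroup ℚ}
    {E : Type} [Field E] [Algebra ℚ E] {ι : AlgebraicClosure ℚ →ₐ[ℚ] AlgebraicClosure E} {ap : ℤ}
    {g : absoluteGaloisGroup E} {c : ℕ → localPoints W E} {col : Chroma}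
    {I : IwasawaH1Data W p κ γ} (C : SharpFlatColemanKatoData W p f ϖ κ γ ι ap g c col I)
    (hirr : W.HasIrreducibleModPGaloisRep p) {Lsharp Lflat G₁ : IwasawaAlgebra p}
    (hSP : IsSprungPair f p ap Lsharp Lflat) (hcol : chromaticL col Lsharp Lflat ≠ 0)
    (hG₁ : iwasawaToPowerSeries p G₁ =
      PowerSeries.C ((ϖ : ℚ) : ℚ_[p]) * iwasawaToPowerSeries p (chromaticL col Lsharp Lflat))
    (D : SharpFlatSelmerDualData W κ γ ι ap g c col) (Y : W.FineSelmerDualData κ γ)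
    (𝔭 : PrimeSpectrum (IwasawaAlgebra p)) (h𝔭 : 𝔭.asIdeal.height = 1) :
    Module.lengthAt (IwasawaAlgebra p) D.X 𝔭 + Module.lengthAt (IwasawaAlgebra p) (I.H ⧸ C.Z) 𝔭 =
      Module.lengthAt (IwasawaAlgebra p) Y.X 𝔭 +
        Module.lengthAt (IwasawaAlgebra p) (IwasawaAlgebra p ⧸ Ideal.span {G₁}) 𝔭 := by
  obtain ⟨j, k, hcj, hjk, hk⟩ := C.exact D Y
  obtain ⟨s, hs, hsG, hZG⟩ := C.image_zeta_localized hirr Lsharp Lflat G₁ hSP hG₁ 𝔭 h𝔭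
  exact lengthAt_add_lengthAt_quotient_eq_of_exact C.colMap (C.colMap_injective Lsharp Lflat hSP hcol)
    j k hcj hjk hk C.Z 𝔭 hs hsG hZG

/-- **Rider-free bound** (drop the `𝐇¹/Z` term): `length_𝔭 X^• ≤ length_𝔭 X₀ + length_𝔭 Λ/(G₁)`; at
`𝔭 = (p)`: `μ(X^•) ≤ μ(X₀) + μ(L^•_p)` at ANY image. [cite: Sprung2012, Prop. 7.19 (p. 1505)] [cite: Kato2004Asterisque, §17.13 (p. 280)] -/
theorem _root_.Literature.NumberTheory.EllipticCurves.Sprung2012.SharpFlatColemanKatoData.lengthAt_le_fine_add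
    [ContinuousSMul ℤ_[p] (W.tateModule p)] [Module.Free ℤ_[p] (W.tateModule p)]
    [Module.Finite ℤ_[p] (W.tateModule p)]
    {N : ℕ} {f : CuspForm (Gamma0 N) 2} {ϖ : ℚ} {κ : ZpExtension ℚ p} {γ : absoluteGaloisGroup ℚ}
    {E : Type} [Field E] [Algebra ℚ E] {ι : AlgebraicClosure ℚ →ₐ[ℚ] AlgebraicClosure E} {ap : ℤ}
    {g : absoluteGaloisGroup E} {c : ℕ → localPoints W E} {col : Chroma}
    {I : IwasawaH1Data W p κ γ} (C : SharpFlatColemanKatoData W p f ϖ κ γ ι ap g c col I)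
    (hirr : W.HasIrreducibleModPGaloisRep p) {Lsharp Lflat G₁ : IwasawaAlgebra p}
    (hSP : IsSprungPair f p ap Lsharp Lflat) (hcol : chromaticL col Lsharp Lflat ≠ 0)
    (hG₁ : iwasawaToPowerSeries p G₁ =
      PowerSeries.C ((ϖ : ℚ) : ℚ_[p]) * iwasawaToPowerSeries p (chromaticL col Lsharp Lflat))
    (D : SharpFlatSelmerDualData W κ γ ι ap g c col) (Y : W.FineSelmerDualData κ γ)
    (𝔭 : PrimeSpectrum (IwasawaAlgebra p)) (h𝔭 : 𝔭.asIdeal.height = 1) :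
    Module.lengthAt (IwasawaAlgebra p) D.X 𝔭 ≤
      Module.lengthAt (IwasawaAlgebra p) Y.X 𝔭 +
        Module.lengthAt (IwasawaAlgebra p) (IwasawaAlgebra p ⧸ Ideal.span {G₁}) 𝔭 := by
  rw [← C.lengthAt_add_eq W p hirr hSP hcol hG₁ D Y 𝔭 h𝔭]
  exact le_self_add

end Package

/-! ### §2 LEMMA B: `μ(X₀(E/ℚ_∞)) = 0 ⟹ μ(X^•) ≤ μ(Λ/(L^•))`, any image, rider-free -/

section LemmaB

variable (W : WeierstrassCurve ℚ) [W.IsElliptic] [W.IsGloballyMinimal] (p : ℕ) [Fact p.Prime]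

/-- **LEMMA B (♯/♭): `length_(p) X₀ = 0 ⟹ length_(p) X^• ≤ length_(p) Λ/(L^•)`, ANY image, ANY
supersingular `a_p`** (odd good `p ∣ a_p`, newform `f`, period ratio `ϖ` of norm `1` displayed,
cyclotomic/Honda setting, colour `•`, Sprung pair with `L^• ≠ 0`, dual data `Y`, `D`). Binder: `hCK` alone
(`E[p]` irreducible from supersingularity; `(G₁) = (L^•)` as `ϖ` is a unit). NO rider, NO `¬Surj`, NO partner.
[cite: Sprung2012, Thm. 7.14 (3) (p. 1504) and Prop. 7.19 (p. 1505)] [cite: Kato2004Asterisque, §17.13 (p. 280)] -/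
theorem sharpFlat_lengthAt_le_of_fine_lengthAt_eq_zero (hCK : thm714seq_sharpFlatColemanKato_zeta)
    (hp : p ≠ 2) (hgood : W.HasGoodReductionAtPrime p) (hap : (p : ℤ) ∣ W.frobeniusTrace p)
    {N : ℕ} [NeZero N] (f : CuspForm (Gamma0 N) 2) (hf : IsNewformOf W f)
    (ϖ : ℚ) (hϖ : (ϖ : ℝ) * W.realPeriodRat = plusPeriod f) (hϖ1 : ‖(ϖ : ℚ_[p])‖ = 1)
    (κ : ZpExtension ℚ p) (γ : absoluteGaloisGroup ℚ) (hκ : κ.IsCyclotomic) (hγ : κ.IsTopGenerator γ)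
    (hγ' : IsCyclotomicVariable p γ)
    (v : HeightOneSpectrum (𝓞 ℚ)) (hv : (p : 𝓞 ℚ) ∈ v.asIdeal)
    (g : absoluteGaloisGroup (v.adicCompletion ℚ))
    (hg : κ.IsTopGenerator (resGalOfEmb (closureEmb (K := ℚ) (v.adicCompletion ℚ)) g))
    (cneg : localPoints W (v.adicCompletion ℚ)) (c : ℕ → localPoints W (v.adicCompletion ℚ))
    (hH : IsHondaSystem κ (closureEmb (K := ℚ) (v.adicCompletion ℚ)) W (W.frobeniusTrace p) g cneg c)
    (col : Chroma) {Lsharp Lflat : IwasawaAlgebra p}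
    (hSP : IsSprungPair f p (W.frobeniusTrace p) Lsharp Lflat) (hcol : chromaticL col Lsharp Lflat ≠ 0)
    (D : SharpFlatSelmerDualData W κ γ (closureEmb (K := ℚ) (v.adicCompletion ℚ))
      (W.frobeniusTrace p) g c col)
    (Y : W.FineSelmerDualData κ γ) (𝔭 : PrimeSpectrum (IwasawaAlgebra p))
    (h𝔭 : 𝔭.asIdeal = IwasawaAlgebra.augIdealP p) (hY : Module.lengthAt (IwasawaAlgebra p) Y.X 𝔭 = 0) :
    Module.lengthAt (IwasawaAlgebra p) D.X 𝔭 ≤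
      Module.lengthAt (IwasawaAlgebra p)
        (IwasawaAlgebra p ⧸ Ideal.span {chromaticL col Lsharp Lflat}) 𝔭 := by
  haveI : ContinuousSMul ℤ_[p] (W.tateModule p) := TateModule.continuousSMul_padicInt
  haveI : Module.Free ℤ_[p] (W.tateModule p) := W.module_free_tateModule_holds p
  haveI : Module.Finite ℤ_[p] (W.tateModule p) := W.module_finite_tateModule_holds p
  have hirr : W.HasIrreducibleModPGaloisRep p :=
    hasIrreducibleModPGaloisRep_of_dvd_frobeniusTrace W p hp
      (W.not_dvd_minimalDiscriminantInt_of_hasGoodReductionAtPrime' p hgood) hap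
  obtain ⟨I⟩ := nonempty_iwasawaH1Data_holds W p κ γ hκ hγ
  obtain ⟨C⟩ := hCK W p f ϖ κ γ hp hgood hap hf hϖ hκ hγ hγ' v hv g hg cneg c hH col I
  -- the period unit: `G₁ := C(u)·L^•` is Néron-normalised and `(G₁) = (L^•)`
  set L : IwasawaAlgebra p := chromaticL col Lsharp Lflat with hLdef
  obtain ⟨hspan, hι⟩ := span_C_units_mul_eq (PadicInt.mkUnits hϖ1) L
  have hG₁ : iwasawaToPowerSeries p (PowerSeries.C ((PadicInt.mkUnits hϖ1 : ℤ_[p]ˣ) : ℤ_[p]) * L) =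
      PowerSeries.C ((ϖ : ℚ) : ℚ_[p]) * iwasawaToPowerSeries p L := by rw [hι, PadicInt.mkUnits_eq]
  have h𝔭1 : 𝔭.asIdeal.height = 1 := by rw [h𝔭]; exact IwasawaAlgebra.height_augIdealP_holds p
  have h := C.lengthAt_le_fine_add W p hirr hSP hcol hG₁ D Y 𝔭 h𝔭1
  rwa [hY, zero_add, hspan] at h

/-- **LEMMA B on X8** (the period unit `|ϖ|₃ = 1` DISCHARGED by the period fact at `3` through
`X8_norm_periodRatio_eq_one`; any image of `ρ̄_{E,3}`): `length_(3) X₀ = 0 ⟹ length_(3) X^• ≤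
length_(3) Λ/(L^•)` for every colour with `L^• ≠ 0`. Binders: `hCK`, `h3`. [cite: Sprung2012, Prop. 7.19 (p. 1505)]
[cite: Kato2004Asterisque, §17.13 (p. 280)] [cite: GreenbergVatsal2000, §3 Remark 3.4] -/
theorem X8.sharpFlat_lengthAt_le_of_fine_lengthAt_eq_zero (hCK : thm714seq_sharpFlatColemanKato_zeta)
    (h3 : realPeriodRat_eq_unit_mul_plusPeriod_three) (hX : ClassX8 W p)
    {N : ℕ} [NeZero N] (f : CuspForm (Gamma0 N) 2) (hf : IsNewformOf W f)
    (ϖ : ℚ) (hϖ : (ϖ : ℝ) * W.realPeriodRat = plusPeriod f)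
    (κ : ZpExtension ℚ p) (γ : absoluteGaloisGroup ℚ) (hκ : κ.IsCyclotomic) (hγ : κ.IsTopGenerator γ)
    (hγ' : IsCyclotomicVariable p γ)
    (v : HeightOneSpectrum (𝓞 ℚ)) (hv : (p : 𝓞 ℚ) ∈ v.asIdeal)
    (g : absoluteGaloisGroup (v.adicCompletion ℚ))
    (hg : κ.IsTopGenerator (resGalOfEmb (closureEmb (K := ℚ) (v.adicCompletion ℚ)) g))
    (cneg : localPoints W (v.adicCompletion ℚ)) (c : ℕ → localPoints W (v.adicCompletion ℚ))
    (hH : IsHondaSystem κ (closureEmb (K := ℚ) (v.adicCompletion ℚ)) W (W.frobeniusTrace p) g cneg c)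
    (col : Chroma) {Lsharp Lflat : IwasawaAlgebra p}
    (hSP : IsSprungPair f p (W.frobeniusTrace p) Lsharp Lflat) (hcol : chromaticL col Lsharp Lflat ≠ 0)
    (D : SharpFlatSelmerDualData W κ γ (closureEmb (K := ℚ) (v.adicCompletion ℚ))
      (W.frobeniusTrace p) g c col)
    (Y : W.FineSelmerDualData κ γ) (𝔭 : PrimeSpectrum (IwasawaAlgebra p))
    (h𝔭 : 𝔭.asIdeal = IwasawaAlgebra.augIdealP p) (hY : Module.lengthAt (IwasawaAlgebra p) Y.X 𝔭 = 0) :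
    Module.lengthAt (IwasawaAlgebra p) D.X 𝔭 ≤
      Module.lengthAt (IwasawaAlgebra p)
        (IwasawaAlgebra p ⧸ Ideal.span {chromaticL col Lsharp Lflat}) 𝔭 := by
  have hϖ1 : ‖(ϖ : ℚ_[p])‖ = 1 := X8_norm_periodRatio_eq_one h3 W p hX hf hϖ
  obtain ⟨hp3, ⟨hgood, hap⟩, -⟩ := hX
  subst hp3
  exact sharpFlat_lengthAt_le_of_fine_lengthAt_eq_zero W 3 hCK (by decide) hgood hap f hf ϖ hϖ hϖ1 κ γ
    hκ hγ hγ' v hv g hg cneg c hH col hSP hcol D Y 𝔭 h𝔭 hY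

/-- `length_(p) Λ/(L)` is finite for `L ≠ 0` (`= m` for `L = p^m·L′`, `p ∤ L′`). [cite: Washington1997, §13.2] -/
theorem lengthAt_quotient_span_ne_top {p : ℕ} [Fact p.Prime] {L : IwasawaAlgebra p} (hL : L ≠ 0)
    (𝔭 : PrimeSpectrum (IwasawaAlgebra p)) (h𝔭 : 𝔭.asIdeal = IwasawaAlgebra.augIdealP p) :
    Module.lengthAt (IwasawaAlgebra p) (IwasawaAlgebra p ⧸ Ideal.span {L}) 𝔭 ≠ ⊤ := by
  obtain ⟨m, L', hL', hLm⟩ := exists_eq_C_pow_mul_not_dvd hL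
  rw [lengthAt_quotient_span_eq_of_eq_C_pow_mul hL' hLm 𝔭 h𝔭]
  exact ENat.coe_ne_top m

/-- **LEMMA B in `μ`-currency on X8 (the conclusion shape of crux 20622):** `length_(3) X₀ = 0 ⟹
muInvariant 3 D.X ≤ muInvariant 3 (Λ ⧸ (L^•))` for every colour with `L^• ≠ 0` (μ = toNat of the local
length at `(3)`, finite on the right since `L^• ≠ 0`). Binders: `hCK`, `h3`. [cite: Sprung2012, Prop. 7.19 (p. 1505)]
[cite: Washington1997, §13.2] -/
theorem X8.sharpFlatMu_le_of_fine_lengthAt_eq_zero (hCK : thm714seq_sharpFlatColemanKato_zeta)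
    (h3 : realPeriodRat_eq_unit_mul_plusPeriod_three) (hX : ClassX8 W p)
    {N : ℕ} [NeZero N] (f : CuspForm (Gamma0 N) 2) (hf : IsNewformOf W f)
    (ϖ : ℚ) (hϖ : (ϖ : ℝ) * W.realPeriodRat = plusPeriod f)
    (κ : ZpExtension ℚ p) (γ : absoluteGaloisGroup ℚ) (hκ : κ.IsCyclotomic) (hγ : κ.IsTopGenerator γ)
    (hγ' : IsCyclotomicVariable p γ)
    (v : HeightOneSpectrum (𝓞 ℚ)) (hv : (p : 𝓞 ℚ) ∈ v.asIdeal)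
    (g : absoluteGaloisGroup (v.adicCompletion ℚ))
    (hg : κ.IsTopGenerator (resGalOfEmb (closureEmb (K := ℚ) (v.adicCompletion ℚ)) g))
    (cneg : localPoints W (v.adicCompletion ℚ)) (c : ℕ → localPoints W (v.adicCompletion ℚ))
    (hH : IsHondaSystem κ (closureEmb (K := ℚ) (v.adicCompletion ℚ)) W (W.frobeniusTrace p) g cneg c)
    (col : Chroma) {Lsharp Lflat : IwasawaAlgebra p}
    (hSP : IsSprungPair f p (W.frobeniusTrace p) Lsharp Lflat) (hcol : chromaticL col Lsharp Lflat ≠ 0)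
    (D : SharpFlatSelmerDualData W κ γ (closureEmb (K := ℚ) (v.adicCompletion ℚ))
      (W.frobeniusTrace p) g c col)
    (hY : ∀ Y : W.FineSelmerDualData κ γ, ∀ 𝔭 : PrimeSpectrum (IwasawaAlgebra p),
      𝔭.asIdeal = IwasawaAlgebra.augIdealP p → Module.lengthAt (IwasawaAlgebra p) Y.X 𝔭 = 0) :
    muInvariant p D.X ≤ muInvariant p (IwasawaAlgebra p ⧸ Ideal.span {chromaticL col Lsharp Lflat}) := by
  let 𝔭 : PrimeSpectrum (IwasawaAlgebra p) :=
    ⟨IwasawaAlgebra.augIdealP p, IwasawaAlgebra.isPrime_augIdealP_holds p⟩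
  obtain ⟨Y⟩ := W.nonempty_fineSelmerDualData κ hγ
  have hle := X8.sharpFlat_lengthAt_le_of_fine_lengthAt_eq_zero W p hCK h3 hX f hf ϖ hϖ κ γ hκ hγ hγ' v
    hv g hg cneg c hH col hSP hcol D Y 𝔭 rfl (hY Y 𝔭 rfl)
  rw [muInvariant_eq_toNat_lengthAt p D.X 𝔭 rfl,
    muInvariant_eq_toNat_lengthAt p (IwasawaAlgebra p ⧸ Ideal.span {chromaticL col Lsharp Lflat}) 𝔭 rfl]
  exact ENat.toNat_le_toNat hle (lengthAt_quotient_span_ne_top hcol 𝔭 rfl)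

end LemmaB

/-! ### §3 ONE colour's unit content ⟹ `length_(p) X₀ = 0` (the core); bridge `μ(Λ/(L)) = 0 ↔` unit content -/

section FineZero

variable (W : WeierstrassCurve ℚ) [W.IsElliptic] [W.IsGloballyMinimal] (p : ℕ) [Fact p.Prime]

/-- **One colour's rider ⟹ `length_(p) X₀(E/ℚ_∞) = 0`** (odd good `p ∣ a_p`, `ρ̄_{E,p}` NOT onto,
newform `f`, `|ϖ|_p = 1`; SOME colour `•₀` with `HasUnitContent (L^{•₀})` ⟹ every dual fine Selmer datum
over the cyclotomic `(κ, γ)` has `length_(p) X₀ = 0`): the `•₀`-package's localized image clause and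
`G₀ ∉ (p)` give a genuine Euler-system class outside `p𝐇¹` (`exists_mem_set_not_mem_pSmul`); the
reduction-free core (`fineSelmerDual_lengthAt_augIdealP_eq_zero_of_eulerSystemClass`) concludes.
[cite: Kato2004Asterisque, Thm. 12.6 (p. 222), §13.8 (pp. 228–229)] [cite: Sprung2012, Def. 6.1 (p. 1495)] -/
theorem fine_lengthAt_eq_zero_of_sharpFlatUnitContent (hCK : thm714seq_sharpFlatColemanKato_zeta)
    (hp : p ≠ 2) (hgood : W.HasGoodReductionAtPrime p) (hap : (p : ℤ) ∣ W.frobeniusTrace p)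
    (hns : ¬ W.HasSurjectiveModNGaloisRep p)
    {N : ℕ} [NeZero N] (f : CuspForm (Gamma0 N) 2) (hf : IsNewformOf W f)
    (ϖ : ℚ) (hϖ : (ϖ : ℝ) * W.realPeriodRat = plusPeriod f) (hϖ1 : ‖(ϖ : ℚ_[p])‖ = 1)
    (κ : ZpExtension ℚ p) (γ : absoluteGaloisGroup ℚ) (hκ : κ.IsCyclotomic) (hγ : κ.IsTopGenerator γ)
    (hγ' : IsCyclotomicVariable p γ)
    (v : HeightOneSpectrum (𝓞 ℚ)) (hv : (p : 𝓞 ℚ) ∈ v.asIdeal)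
    (g : absoluteGaloisGroup (v.adicCompletion ℚ))
    (hg : κ.IsTopGenerator (resGalOfEmb (closureEmb (K := ℚ) (v.adicCompletion ℚ)) g))
    (cneg : localPoints W (v.adicCompletion ℚ)) (c : ℕ → localPoints W (v.adicCompletion ℚ))
    (hH : IsHondaSystem κ (closureEmb (K := ℚ) (v.adicCompletion ℚ)) W (W.frobeniusTrace p) g cneg c)
    (col₀ : Chroma) {Lsharp Lflat : IwasawaAlgebra p}
    (hSP : IsSprungPair f p (W.frobeniusTrace p) Lsharp Lflat)
    (hu₀ : HasUnitContent (chromaticL col₀ Lsharp Lflat))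
    (Y : W.FineSelmerDualData κ γ) (𝔭 : PrimeSpectrum (IwasawaAlgebra p))
    (h𝔭 : 𝔭.asIdeal = IwasawaAlgebra.augIdealP p) :
    Module.lengthAt (IwasawaAlgebra p) Y.X 𝔭 = 0 := by
  haveI : ContinuousSMul ℤ_[p] (W.tateModule p) := TateModule.continuousSMul_padicInt
  haveI : Module.Free ℤ_[p] (W.tateModule p) := W.module_free_tateModule_holds p
  haveI : Module.Finite ℤ_[p] (W.tateModule p) := W.module_finite_tateModule_holds p
  have hirr : W.HasIrreducibleModPGaloisRep p :=
    hasIrreducibleModPGaloisRep_of_dvd_frobeniusTrace W p hp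
      (W.not_dvd_minimalDiscriminantInt_of_hasGoodReductionAtPrime' p hgood) hap
  obtain ⟨I⟩ := nonempty_iwasawaH1Data_holds W p κ γ hκ hγ
  obtain ⟨K₀⟩ := hCK W p f ϖ κ γ hp hgood hap hf hϖ hκ hγ hγ' v hv g hg cneg c hH col₀ I
  set L₀ : IwasawaAlgebra p := chromaticL col₀ Lsharp Lflat with hL₀def
  obtain ⟨-, hι₀⟩ := span_C_units_mul_eq (PadicInt.mkUnits hϖ1) L₀
  set G₀ : IwasawaAlgebra p := PowerSeries.C ((PadicInt.mkUnits hϖ1 : ℤ_[p]ˣ) : ℤ_[p]) * L₀ with hG₀def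
  have hG₀ : iwasawaToPowerSeries p G₀ =
      PowerSeries.C ((ϖ : ℚ) : ℚ_[p]) * iwasawaToPowerSeries p L₀ := by rw [hι₀, PadicInt.mkUnits_eq]
  have hL₀p : L₀ ∉ IwasawaAlgebra.augIdealP p := KatoMuSkeleton.not_mem_augIdealP_of_hasUnitContent hu₀
  have hG₀p : G₀ ∉ IwasawaAlgebra.augIdealP p := by
    intro h
    apply hL₀p
    have h' := Ideal.mul_mem_left (IwasawaAlgebra.augIdealP p)
      (PowerSeries.C (((PadicInt.mkUnits hϖ1)⁻¹ : ℤ_[p]ˣ) : ℤ_[p])) h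
    rwa [hG₀def, ← mul_assoc, ← map_mul, Units.inv_mul, map_one, one_mul] at h'
  have h𝔭1 : 𝔭.asIdeal.height = 1 := by rw [h𝔭]; exact IwasawaAlgebra.height_augIdealP_holds p
  obtain ⟨s₀, hs₀, hs₀G, -⟩ := K₀.image_zeta_localized hirr Lsharp Lflat G₀ hSP hG₀ 𝔭 h𝔭1
  have hs₀' : s₀ ∉ IwasawaAlgebra.augIdealP p := h𝔭 ▸ hs₀
  obtain ⟨z, hzES, hzp⟩ := exists_mem_set_not_mem_pSmul K₀.colMap K₀.Z K₀.zeta_le_span hs₀' hG₀p hs₀G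
  exact (fineSelmerDual_lengthAt_augIdealP_eq_zero_of_eulerSystemClass W p κ γ I hp hirr hns hκ hγ
    ⟨z, hzES, hzp⟩ Y 𝔭 h𝔭).2

/-- **The same on X8 ∩ {ρ̄_{E,3} not onto}**, period unit discharged by the period fact at `3`.
[cite: Kato2004Asterisque, Thm. 12.6 (p. 222), §13.8] [cite: GreenbergVatsal2000, §3 Remark 3.4] -/
theorem X8.fine_lengthAt_eq_zero_of_sharpFlatUnitContent (hCK : thm714seq_sharpFlatColemanKato_zeta)
    (h3 : realPeriodRat_eq_unit_mul_plusPeriod_three) (hX : ClassX8 W p) (hns : ¬ Surj W p)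
    {N : ℕ} [NeZero N] (f : CuspForm (Gamma0 N) 2) (hf : IsNewformOf W f)
    (ϖ : ℚ) (hϖ : (ϖ : ℝ) * W.realPeriodRat = plusPeriod f)
    (κ : ZpExtension ℚ p) (γ : absoluteGaloisGroup ℚ) (hκ : κ.IsCyclotomic) (hγ : κ.IsTopGenerator γ)
    (hγ' : IsCyclotomicVariable p γ)
    (v : HeightOneSpectrum (𝓞 ℚ)) (hv : (p : 𝓞 ℚ) ∈ v.asIdeal)
    (g : absoluteGaloisGroup (v.adicCompletion ℚ))
    (hg : κ.IsTopGenerator (resGalOfEmb (closureEmb (K := ℚ) (v.adicCompletion ℚ)) g))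
    (cneg : localPoints W (v.adicCompletion ℚ)) (c : ℕ → localPoints W (v.adicCompletion ℚ))
    (hH : IsHondaSystem κ (closureEmb (K := ℚ) (v.adicCompletion ℚ)) W (W.frobeniusTrace p) g cneg c)
    (col₀ : Chroma) {Lsharp Lflat : IwasawaAlgebra p}
    (hSP : IsSprungPair f p (W.frobeniusTrace p) Lsharp Lflat)
    (hu₀ : HasUnitContent (chromaticL col₀ Lsharp Lflat))
    (Y : W.FineSelmerDualData κ γ) (𝔭 : PrimeSpectrum (IwasawaAlgebra p))
    (h𝔭 : 𝔭.asIdeal = IwasawaAlgebra.augIdealP p) :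
    Module.lengthAt (IwasawaAlgebra p) Y.X 𝔭 = 0 := by
  have hϖ1 : ‖(ϖ : ℚ_[p])‖ = 1 := X8_norm_periodRatio_eq_one h3 W p hX hf hϖ
  obtain ⟨hp3, ⟨hgood, hap⟩, -⟩ := hX
  subst hp3
  exact fine_lengthAt_eq_zero_of_sharpFlatUnitContent W 3 hCK (by decide) hgood hap hns f hf ϖ hϖ hϖ1 κ
    γ hκ hγ hγ' v hv g hg cneg c hH col₀ hSP hu₀ Y 𝔭 h𝔭

/-- **Bridge: for `L ≠ 0`, `μ(Λ/(L)) = 0 ↔ L` has a unit coefficient** (`L = p^m·L′` with `p ∤ L′`,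
`μ(Λ/(L)) = m`; unit content `↔ p ∤ L ↔ m = 0`). [cite: Washington1997, §7.1, §13.2] -/
theorem muInvariant_quotient_span_eq_zero_iff_hasUnitContent {p : ℕ} [Fact p.Prime]
    {L : IwasawaAlgebra p} (hL : L ≠ 0) :
    muInvariant p (IwasawaAlgebra p ⧸ Ideal.span {L}) = 0 ↔ HasUnitContent L := by
  let 𝔭 : PrimeSpectrum (IwasawaAlgebra p) :=
    ⟨IwasawaAlgebra.augIdealP p, IwasawaAlgebra.isPrime_augIdealP_holds p⟩
  obtain ⟨m, L', hL', hLm⟩ := exists_eq_C_pow_mul_not_dvd hL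
  rw [muInvariant_eq_toNat_lengthAt p (IwasawaAlgebra p ⧸ Ideal.span {L}) 𝔭 rfl,
    lengthAt_quotient_span_eq_of_eq_C_pow_mul hL' hLm 𝔭 rfl, ENat.toNat_coe,
    hasUnitContent_iff_not_C_dvd]
  constructor
  · rintro rfl
    rw [pow_zero, one_mul] at hLm
    rw [hLm]
    exact hL'
  · intro hnd
    by_contra hm
    apply hnd
    rw [hLm]
    exact dvd_mul_of_dvd_left (dvd_pow_self _ hm) L'

end FineZero

/-! ### §4 PER PAIR: ONE colour's rider ⟹ the `μ`-bound for EVERY colour (the planner's BC3 stub shape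
`stub_muTransfer_of_oneColourMuZero`) -/

section OneColour

variable (W : WeierstrassCurve ℚ) [W.IsElliptic] [W.IsGloballyMinimal] (p : ℕ) [Fact p.Prime]

/-- **X8, `ρ̄_{E,3}` NOT onto: ONE colour `•₀` of unit content ⟹ `μ(X^•) ≤ μ(Λ/(L^•))` for EVERY colour
`•` with `L^• ≠ 0`** (for the same newform / Sprung pair / cyclotomic–Honda datum). §3 (`length_(3) X₀ =
0` from the `•₀`-rider) ∘ §2 (LEMMA B in `μ`-currency). Binders: `hCK`, `h3`; displayed: the one-colour
rider `hu₀`. NO K1, NO partner, NO congruence. [cite: Sprung2012, Def. 6.1 (p. 1495), Prop. 7.19 (p. 1505)]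
[cite: Kato2004Asterisque, Thm. 12.6 (p. 222), §13.8, §17.13 (p. 280)] -/
theorem X8.sharpFlatMu_le_of_oneColour_hasUnitContent (hCK : thm714seq_sharpFlatColemanKato_zeta)
    (h3 : realPeriodRat_eq_unit_mul_plusPeriod_three) (hX : ClassX8 W p) (hns : ¬ Surj W p)
    {N : ℕ} [NeZero N] (f : CuspForm (Gamma0 N) 2) (hf : IsNewformOf W f)
    (ϖ : ℚ) (hϖ : (ϖ : ℝ) * W.realPeriodRat = plusPeriod f)
    (κ : ZpExtension ℚ p) (γ : absoluteGaloisGroup ℚ) (hκ : κ.IsCyclotomic) (hγ : κ.IsTopGenerator γ)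
    (hγ' : IsCyclotomicVariable p γ)
    (v : HeightOneSpectrum (𝓞 ℚ)) (hv : (p : 𝓞 ℚ) ∈ v.asIdeal)
    (g : absoluteGaloisGroup (v.adicCompletion ℚ))
    (hg : κ.IsTopGenerator (resGalOfEmb (closureEmb (K := ℚ) (v.adicCompletion ℚ)) g))
    (cneg : localPoints W (v.adicCompletion ℚ)) (c : ℕ → localPoints W (v.adicCompletion ℚ))
    (hH : IsHondaSystem κ (closureEmb (K := ℚ) (v.adicCompletion ℚ)) W (W.frobeniusTrace p) g cneg c)
    {Lsharp Lflat : IwasawaAlgebra p} (hSP : IsSprungPair f p (W.frobeniusTrace p) Lsharp Lflat)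
    (col₀ : Chroma) (hu₀ : HasUnitContent (chromaticL col₀ Lsharp Lflat))
    (col : Chroma) (hcol : chromaticL col Lsharp Lflat ≠ 0)
    (D : SharpFlatSelmerDualData W κ γ (closureEmb (K := ℚ) (v.adicCompletion ℚ))
      (W.frobeniusTrace p) g c col) :
    muInvariant p D.X ≤ muInvariant p (IwasawaAlgebra p ⧸ Ideal.span {chromaticL col Lsharp Lflat}) :=
  X8.sharpFlatMu_le_of_fine_lengthAt_eq_zero W p hCK h3 hX f hf ϖ hϖ κ γ hκ hγ hγ' v hv g hg cneg c hH
    col hSP hcol D fun Y 𝔭 h𝔭 ↦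
      X8.fine_lengthAt_eq_zero_of_sharpFlatUnitContent W p hCK h3 hX hns f hf ϖ hϖ κ γ hκ hγ hγ' v hv g hg
        cneg c hH col₀ hSP hu₀ Y 𝔭 h𝔭

/-- **The same with the rider spelled as in the planner's stub: ONE colour `•₀` with `L^{•₀} ≠ 0` and
`μ(Λ/(L^{•₀})) = 0`** (bridge `muInvariant_quotient_span_eq_zero_iff_hasUnitContent`).
[cite: Sprung2012, Def. 6.1 (p. 1495), Prop. 7.19 (p. 1505)] [cite: Washington1997, §13.2] -/
theorem X8.sharpFlatMu_le_of_oneColour_muZero (hCK : thm714seq_sharpFlatColemanKato_zeta)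
    (h3 : realPeriodRat_eq_unit_mul_plusPeriod_three) (hX : ClassX8 W p) (hns : ¬ Surj W p)
    {N : ℕ} [NeZero N] (f : CuspForm (Gamma0 N) 2) (hf : IsNewformOf W f)
    (ϖ : ℚ) (hϖ : (ϖ : ℝ) * W.realPeriodRat = plusPeriod f)
    (κ : ZpExtension ℚ p) (γ : absoluteGaloisGroup ℚ) (hκ : κ.IsCyclotomic) (hγ : κ.IsTopGenerator γ)
    (hγ' : IsCyclotomicVariable p γ)
    (v : HeightOneSpectrum (𝓞 ℚ)) (hv : (p : 𝓞 ℚ) ∈ v.asIdeal)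
    (g : absoluteGaloisGroup (v.adicCompletion ℚ))
    (hg : κ.IsTopGenerator (resGalOfEmb (closureEmb (K := ℚ) (v.adicCompletion ℚ)) g))
    (cneg : localPoints W (v.adicCompletion ℚ)) (c : ℕ → localPoints W (v.adicCompletion ℚ))
    (hH : IsHondaSystem κ (closureEmb (K := ℚ) (v.adicCompletion ℚ)) W (W.frobeniusTrace p) g cneg c)
    {Lsharp Lflat : IwasawaAlgebra p} (hSP : IsSprungPair f p (W.frobeniusTrace p) Lsharp Lflat)
    (col₀ : Chroma) (hcol₀ : chromaticL col₀ Lsharp Lflat ≠ 0)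
    (hμ₀ : muInvariant p (IwasawaAlgebra p ⧸ Ideal.span {chromaticL col₀ Lsharp Lflat}) = 0)
    (col : Chroma) (hcol : chromaticL col Lsharp Lflat ≠ 0)
    (D : SharpFlatSelmerDualData W κ γ (closureEmb (K := ℚ) (v.adicCompletion ℚ))
      (W.frobeniusTrace p) g c col) :
    muInvariant p D.X ≤ muInvariant p (IwasawaAlgebra p ⧸ Ideal.span {chromaticL col Lsharp Lflat}) :=
  X8.sharpFlatMu_le_of_oneColour_hasUnitContent W p hCK h3 hX hns f hf ϖ hϖ κ γ hκ hγ hγ' v hv g hg cneg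
    c hH hSP col₀ ((muInvariant_quotient_span_eq_zero_iff_hasUnitContent hcol₀).mp hμ₀) col hcol D

end OneColour

end Summit.BirchSwinnertonDyer.BirchSwinnertonDyer.Theorems.PrintX8SharpFlatMuTransfer

end
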